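import Summits.MatrixMultiplication.OmegaCensus.STPPRepresentationCount

/-!
# ω-census: the deficiency analysis behind the cube non-beating theorem (abstract additive combinatorics)

HONEST FRAMING (pub-omega census; verbatim): lottery ticket; floor = certified bounds/negative ranges.
Census STRUCTURE (seat pub-omega-stpp-1 gen 24, 2026-08-27).  Nothing here mentions matrix multiplication: this file is the
abstract core of `STPP222NeverBeats.lean`, about three finsets `X, Y, Z` of a finite abelian group `H` with

  `#X = #Y = #Z = m`  and  `rep X Y z = 2` for every `z ∈ Z`  (exactly two representations `z = x + y`).

(For a `(2,2,2)^k` STPP family, `X = ⋃(Bᵢ − Aᵢ)`, `Y = ⋃(Cᵢ − Bᵢ)`, `Z = ⋃(Cᵢ − Aᵢ)` have this property with `m = 4k`: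
`STPPRepresentationCount.rep_eq_card_B`.)  Write `n = |H|`.

* Step 0 (`two_mul_le_card_add_two`): pigeonhole at one `z ∈ Z` gives `n ≥ 2m − 2`.
* Step A (`card_ne_two_mul_sub_two`, `m ≥ 5`): `n ≠ 2m − 2`.  Off `Z` the `m − 2` values `rep X Y g` sum to `m(m − 2)`, so all
  equal `m`, i.e. `X = g − Y` for every `g ∉ Z`; then all differences `g − g₀` stabilise `Y`, so `|Stab Y| ≥ m − 2`, while
  `|Stab Y|` divides `#Y = m` and `n = 2m − 2`, hence divides `2` — absurd.
* Step B (`n = 2m − 1`), the near-periods: at most ONE `g` has `rep = m` (`card_filter_rep_eq_le_one`: two of them differ by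
  an element of `Stab Y`, whose order divides `gcd(m, 2m − 1) = 1`); the set `T` of `g ∉ Z` with `rep ≥ m − 1` has
  `#T ≥ m − 3` (`le_card_nearFull`, deficiency count); for `g, g' ∈ T` the translates `g − Y`, `g' − Y` differ from `X` in at
  most one point each way, so `dif Y (g − g') ≥ m − 2` (`le_dif_of_mem_nearFull`); hence every element of `E = T − T` is a
  near-period of `Y` (`le_dif_of_mem_E`), and double counting `Σ_δ dif Y δ = m²` with `dif ≥ 1` everywhere gives
  `#E ≤ m + 1` (`card_E_le`, `m ≥ 6`).
The contradiction (Kneser on `T − T`, the stabilizer `K`, the fibre bound) is drawn in `STPP222NeverBeats.lean`.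

References: M. Kneser, Math. Z. 58 (1953); M. B. Nathanson, GTM 165, §4.1; the tree's `Literature.Combinatorics.Additive.Kneser`.
-/

open Finset
open scoped Pointwise

namespace Summit.MatrixMultiplication.OmegaCensus.CubeNB

variable {H : Type*} [AddCommGroup H] [DecidableEq H]

/-! ## Full representation: `rep X Y g = #X` means `X = g − Y`, and then differences of two such `g` stabilise `Y` -/

/-- If `rep X Y g = #X` and `#X = #Y` then `X = g − Y`. [folklore] -/
theorem eq_image_of_rep_eq {X Y : Finset H} {g : H} (hXY : #X = #Y) (h : rep X Y g = #X) :
    X = Y.image (fun y => g - y) := by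
  have hsub : X ⊆ Y.image (fun y => g - y) := by
    have hf : X.filter (fun x => g - x ∈ Y) = X := eq_of_subset_of_card_le (filter_subset _ _) (by rw [← rep]; omega)
    intro x hx
    rw [← hf] at hx
    exact (mem_image_sub_iff Y g x).2 (mem_filter.1 hx).2
  exact eq_of_subset_of_card_le hsub (by rw [card_image_sub, hXY])

/-- If `X = g₁ − Y = g₂ − Y` then `g₁ − g₂` stabilises `Y`. [folklore] -/
theorem sub_mem_addStab_of_eq_image {X Y : Finset H} {g₁ g₂ : H} (h₁ : X = Y.image (fun y => g₁ - y))
    (h₂ : X = Y.image (fun y => g₂ - y)) (hY : Y.Nonempty) : g₁ - g₂ ∈ Y.addStab := by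
  rw [Finset.mem_addStab_iff_vadd_finset_subset hY]
  intro w hw
  obtain ⟨y, hy, rfl⟩ := Finset.mem_vadd_finset.1 hw
  have : g₂ - y ∈ X := by rw [h₂]; exact mem_image.2 ⟨y, hy, rfl⟩
  rw [h₁] at this
  obtain ⟨y', hy', he⟩ := mem_image.1 this
  have : y' = (g₁ - g₂) +ᵥ y := by
    rw [vadd_eq_add]
    have h3 : y' = g₁ - (g₂ - y) := by rw [← he]; abel
    rw [h3]; abel
  rw [← this]; exact hy'

/-! ## The deficiency analysis at `|H| = 2m − 1` -/

section Core

variable [Fintype H] {X Y Z : Finset H} {m : ℕ}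

/-- Step 0: `2m ≤ |H| + 2`. [folklore] -/
theorem two_mul_le_card_add_two (hX : #X = m) (hY : #Y = m) (hZne : Z.Nonempty)
    (hrep : ∀ z ∈ Z, rep X Y z = 2) : 2 * m ≤ Fintype.card H + 2 := by
  obtain ⟨z, hz⟩ := hZne
  have := card_add_card_le_rep_add X Y z
  rw [hrep z hz, hX, hY] at this
  omega

/-- Sum of `rep` off `Z`: `Σ_{g ∉ Z} rep X Y g = m² − 2m` (stated additively). [folklore] -/
theorem sum_rep_compl (hX : #X = m) (hY : #Y = m) (hrep : ∀ z ∈ Z, rep X Y z = 2) :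
    ∑ g ∈ univ \ Z, rep X Y g + 2 * #Z = m * m := by
  have h1 : ∑ g ∈ Z, rep X Y g = 2 * #Z := by
    rw [sum_congr rfl hrep, sum_const, smul_eq_mul, mul_comm]
  have h2 := sum_sdiff (f := fun g => rep X Y g) (subset_univ Z)
  rw [sum_rep, hX, hY] at h2
  omega

/-- Step A: `|H| ≠ 2m − 2` (for `m ≥ 5`). [folklore] -/
theorem card_ne_two_mul_sub_two (hm : 5 ≤ m) (hX : #X = m) (hY : #Y = m) (hZ : #Z = m)
    (hrep : ∀ z ∈ Z, rep X Y z = 2) (hcard : Fintype.card H = 2 * m - 2) : False := by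
  have hsum := sum_rep_compl hX hY hrep
  rw [hZ] at hsum
  -- `W = univ \ Z` has `m - 2` elements and `Σ_W rep = m (m - 2)` with each term `≤ m`: all are `= m`.
  have hW : #(univ \ Z) = m - 2 := by rw [card_sdiff_of_subset (subset_univ _), card_univ, hcard, hZ]; omega
  have hall : ∀ g ∈ univ \ Z, rep X Y g = m := by
    have hle : ∀ g ∈ univ \ Z, rep X Y g ≤ m := fun g _ => hX ▸ rep_le_left X Y g
    refine (sum_eq_sum_iff_of_le hle).1 ?_
    rw [sum_const, smul_eq_mul, hW]
    have : m * m = (m - 2) * m + 2 * m := by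
      zify [show 2 ≤ m by omega]; ring
    omega
  have hYne : Y.Nonempty := card_pos.1 (by omega)
  -- pick g₀ ∈ W; all g - g₀ (g ∈ W) stabilise Y
  have hWne : (univ \ Z).Nonempty := card_pos.1 (by rw [hW]; omega)
  obtain ⟨g₀, hg₀⟩ := hWne
  have hX0 := eq_image_of_rep_eq (hX.trans hY.symm) ((hall g₀ hg₀).trans hX.symm)
  have hsub : (univ \ Z).image (fun g => g - g₀) ⊆ Y.addStab := by
    intro d hd
    obtain ⟨g, hg, rfl⟩ := mem_image.1 hd
    exact sub_mem_addStab_of_eq_image (eq_image_of_rep_eq (hX.trans hY.symm) ((hall g hg).trans hX.symm)) hX0 hYne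
  have hcardK : m - 2 ≤ #Y.addStab := by
    have := card_le_card hsub
    rwa [card_image_of_injective _ (sub_left_injective), hW] at this
  have hdvdY : #Y.addStab ∣ m := hY ▸ Finset.card_addStab_dvd_card Y
  have hdvdH : #Y.addStab ∣ 2 * m - 2 := hcard ▸ hYne.card_addStab_dvd_card_univ
  have hdvd2 : #Y.addStab ∣ 2 := by
    have h := Nat.dvd_sub (dvd_mul_of_dvd_right hdvdY 2) hdvdH
    rwa [show 2 * m - (2 * m - 2) = 2 by omega] at h
  have := Nat.le_of_dvd (by norm_num) hdvd2
  omega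

end Core


section StepB

variable [Fintype H] {X Y Z : Finset H} {m : ℕ}

/-- At `|H| = 2m − 1`: at most one `g` has full representation `rep X Y g = m`. [folklore] -/
theorem card_filter_rep_eq_le_one (hm : 2 ≤ m) (hX : #X = m) (hY : #Y = m) (hcard : Fintype.card H = 2 * m - 1)
    (S : Finset H) : #(S.filter fun g => rep X Y g = m) ≤ 1 := by
  have hYne : Y.Nonempty := card_pos.1 (by omega)
  have hK1 : #Y.addStab = 1 := by
    have hdvdY : #Y.addStab ∣ m := hY ▸ Finset.card_addStab_dvd_card Y
    have hdvdH : #Y.addStab ∣ 2 * m - 1 := hcard ▸ hYne.card_addStab_dvd_card_univ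
    have h := Nat.dvd_sub (dvd_mul_of_dvd_right hdvdY 2) hdvdH
    rw [show 2 * m - (2 * m - 1) = 1 by omega] at h
    exact Nat.eq_one_of_dvd_one h
  refine card_le_one.2 fun g₁ hg₁ g₂ hg₂ => ?_
  rw [mem_filter] at hg₁ hg₂
  have h := sub_mem_addStab_of_eq_image (eq_image_of_rep_eq (hX.trans hY.symm) (hg₁.2.trans hX.symm))
    (eq_image_of_rep_eq (hX.trans hY.symm) (hg₂.2.trans hX.symm)) hYne
  have h0 : (0 : H) ∈ Y.addStab := (Finset.zero_mem_addStab).2 hYne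
  exact sub_eq_zero.1 (card_le_one.1 hK1.le _ h _ h0)

/-- The set `T` of near-full points: `g ∉ Z` with `rep X Y g ≥ m − 1`. [folklore] -/
def nearFull (X Y Z : Finset H) (m : ℕ) : Finset H := (univ \ Z).filter fun g => m - 1 ≤ rep X Y g

/-- At `|H| = 2m − 1`: `#T ≥ m − 3`. [folklore] -/
theorem le_card_nearFull (hm : 2 ≤ m) (hX : #X = m) (hY : #Y = m) (hZ : #Z = m)
    (hrep : ∀ z ∈ Z, rep X Y z = 2) (hcard : Fintype.card H = 2 * m - 1) : m ≤ #(nearFull X Y Z m) + 3 := by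
  show m ≤ #((univ \ Z).filter fun g => m - 1 ≤ rep X Y g) + 3
  have hsum := sum_rep_compl hX hY hrep
  rw [hZ] at hsum
  have hW : #(univ \ Z) = m - 1 := by rw [card_sdiff_of_subset (subset_univ _), card_univ, hcard, hZ]; omega
  have hsplit := sum_filter_add_sum_filter_not (univ \ Z) (fun g => m - 1 ≤ rep X Y g) (fun g => rep X Y g)
  have hcardTU := card_filter_add_card_filter_not (s := univ \ Z) (fun g => m - 1 ≤ rep X Y g)
  rw [hW] at hcardTU
  -- the complement `U`: every term is `≤ m - 2`
  have hU : ∑ g ∈ (univ \ Z).filter (fun g => ¬ m - 1 ≤ rep X Y g), rep X Y g ≤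
      #((univ \ Z).filter fun g => ¬ m - 1 ≤ rep X Y g) * (m - 2) := by
    rw [← smul_eq_mul]
    exact sum_le_card_nsmul _ _ _ fun g hg => by rw [mem_filter] at hg; omega
  -- `T`: split by `rep = m` (at most one point) versus `rep = m - 1`
  have hT : ∑ g ∈ (univ \ Z).filter (fun g => m - 1 ≤ rep X Y g), rep X Y g ≤
      #((univ \ Z).filter fun g => m - 1 ≤ rep X Y g) * (m - 1) + 1 := by
    set T := (univ \ Z).filter (fun g => m - 1 ≤ rep X Y g) with hTdef
    have hsplit2 := sum_filter_add_sum_filter_not T (fun g => rep X Y g = m) (fun g => rep X Y g)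
    have h0 : ∑ g ∈ T.filter (fun g => rep X Y g = m), rep X Y g ≤ #(T.filter fun g => rep X Y g = m) * m := by
      rw [← smul_eq_mul]
      exact sum_le_card_nsmul _ _ _ fun g hg => by rw [mem_filter] at hg; omega
    have h1 : ∑ g ∈ T.filter (fun g => ¬ rep X Y g = m), rep X Y g ≤
        #(T.filter fun g => ¬ rep X Y g = m) * (m - 1) := by
      rw [← smul_eq_mul]
      refine sum_le_card_nsmul _ _ _ fun g hg => ?_
      rw [mem_filter] at hg
      have := hX ▸ rep_le_left X Y g
      omega
    have hc := card_filter_rep_eq_le_one hm hX hY hcard T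
    have hcc := card_filter_add_card_filter_not (s := T) (fun g => rep X Y g = m)
    have h2 : #(T.filter fun g => rep X Y g = m) * m ≤ #(T.filter fun g => rep X Y g = m) * (m - 1) + 1 := by
      interval_cases h : #(T.filter fun g => rep X Y g = m) <;> omega
    have h3 : #(T.filter fun g => rep X Y g = m) * (m - 1) + #(T.filter fun g => ¬ rep X Y g = m) * (m - 1) =
        #T * (m - 1) := by rw [← hcc, add_mul]
    omega
  -- arithmetic with `t = #T`, `u = #U`, `t + u = m - 1`
  set t := #((univ \ Z).filter fun g => m - 1 ≤ rep X Y g) with ht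
  set u := #((univ \ Z).filter fun g => ¬ m - 1 ≤ rep X Y g) with hu
  obtain ⟨b, hb⟩ : ∃ b, m = b + 2 := ⟨m - 2, by omega⟩
  have e0 : m - 1 = b + 1 := by omega
  have e2 : m - 2 = b := by omega
  have key : m * m ≤ t * (m - 1) + 1 + u * (m - 2) + 2 * m := by
    calc m * m = ∑ g ∈ univ \ Z, rep X Y g + 2 * m := hsum.symm
      _ ≤ _ := by rw [← hsplit]; exact Nat.add_le_add_right (add_le_add hT hU) _
  rw [e0, e2] at key
  rw [e0] at hcardTU
  have e3 : u * b + t * b = (b + 1) * b := by rw [← add_mul, add_comm, hcardTU]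
  rw [hb] at key
  have e4 : (b + 2) * (b + 2) = b * b + 4 * b + 4 := by ring
  have e5 : t * (b + 1) = t * b + t := by ring
  have e6 : (b + 1) * b = b * b + b := by ring
  rw [e4, e5] at key
  rw [e6] at e3
  omega

/-- For `g ∈ T`: the translate `g − Y` misses at most one point of `X` and vice versa. [folklore] -/
theorem card_sdiff_le_one_of_mem_nearFull (hX : #X = m) (hY : #Y = m) {g : H} (hg : g ∈ nearFull X Y Z m) :
    #(Y.image (fun y => g - y) \ X) ≤ 1 ∧ #(X \ Y.image (fun y => g - y)) ≤ 1 := by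
  rw [nearFull, mem_filter] at hg
  have hr : m - 1 ≤ #(X ∩ Y.image (fun y => g - y)) := by rw [← filter_eq_inter_image]; exact hg.2
  have h1 := card_sdiff_add_card_inter (Y.image fun y => g - y) X
  have h2 := card_sdiff_add_card_inter X (Y.image fun y => g - y)
  rw [inter_comm] at h1
  rw [card_image_sub, hY] at h1
  rw [hX] at h2
  omega

/-- For `g, g' ∈ T`: `dif Y (g − g') ≥ m − 2`. [folklore] -/
theorem le_dif_of_mem_nearFull (hX : #X = m) (hY : #Y = m) {g g' : H} (hg : g ∈ nearFull X Y Z m)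
    (hg' : g' ∈ nearFull X Y Z m) : m ≤ dif Y (g - g') + 2 := by
  have himage : Y.image (fun y => g - y) ∩ Y.image (fun y => g' - y) =
      (Y.filter fun y => y - (g - g') ∈ Y).image (fun y => g - y) := by
    ext x
    simp only [mem_inter, mem_image, mem_filter]
    constructor
    · rintro ⟨⟨y, hy, rfl⟩, ⟨y', hy', he⟩⟩
      refine ⟨y, ⟨hy, ?_⟩, rfl⟩
      have h3 : y' = g' - (g' - y') := (sub_sub_cancel g' y').symm
      rw [he] at h3
      have h4 : y - (g - g') = y' := by rw [h3]; abel
      rw [h4]; exact hy'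
    · rintro ⟨y, ⟨hy, hyy⟩, rfl⟩
      exact ⟨⟨y, hy, rfl⟩, ⟨y - (g - g'), hyy, by abel⟩⟩
  have hcard : #(Y.image (fun y => g - y) ∩ Y.image (fun y => g' - y)) = dif Y (g - g') := by
    rw [himage, card_image_of_injective _ (sub_right_injective), dif]
  have hsub : Y.image (fun y => g - y) \ Y.image (fun y => g' - y) ⊆
      (Y.image (fun y => g - y) \ X) ∪ (X \ Y.image (fun y => g' - y)) := by
    intro x hx
    rw [mem_sdiff] at hx
    by_cases hxX : x ∈ X
    · exact mem_union_right _ (mem_sdiff.2 ⟨hxX, hx.2⟩)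
    · exact mem_union_left _ (mem_sdiff.2 ⟨hx.1, hxX⟩)
  have h1 := (card_le_card hsub).trans (card_union_le _ _)
  have h2 := (card_sdiff_le_one_of_mem_nearFull hX hY hg).1
  have h3 := (card_sdiff_le_one_of_mem_nearFull hX hY hg').2
  have h4 := card_sdiff_add_card_inter (Y.image fun y => g - y) (Y.image fun y => g' - y)
  rw [card_image_sub, hY, hcard] at h4
  omega

/-- The difference set `E = T − T` (as `T + (−T)`): every element is a near-period of `Y`. [folklore] -/
theorem le_dif_of_mem_E (hX : #X = m) (hY : #Y = m) {δ : H}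
    (hδ : δ ∈ nearFull X Y Z m + -nearFull X Y Z m) : m ≤ dif Y δ + 2 := by
  obtain ⟨g, hg, e, he, rfl⟩ := mem_add.1 hδ
  rw [Finset.mem_neg'] at he
  have := le_dif_of_mem_nearFull hX hY hg he
  rwa [sub_neg_eq_add] at this

/-- `#E ≤ m + 1` at `|H| = 2m − 1` (`m ≥ 6`), for any `E ∋ 0` consisting of near-periods. [folklore] -/
theorem card_E_le (hm : 6 ≤ m) (hY : #Y = m) (hcard : Fintype.card H = 2 * m - 1)
    {E : Finset H} (h0 : (0 : H) ∈ E) (hE : ∀ δ ∈ E, m ≤ dif Y δ + 2) : #E ≤ m + 1 := by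
  have htot := sum_dif Y
  rw [hY] at htot
  have hs1 := sum_sdiff (f := fun δ => dif Y δ) (subset_univ E)
  have hs2 := sum_erase_add E (fun δ => dif Y δ) h0
  rw [dif_zero, hY] at hs2
  have hn : Fintype.card H + 1 = 2 * m := by omega
  have hA : #(E.erase 0) * m ≤ ∑ δ ∈ E.erase 0, dif Y δ + 2 * #(E.erase 0) := by
    have h2 : ∑ δ ∈ E.erase 0, m ≤ ∑ δ ∈ E.erase 0, (dif Y δ + 2) :=
      sum_le_sum fun δ hδ => hE δ (mem_of_mem_erase hδ)
    rw [sum_add_distrib, sum_const, sum_const, smul_eq_mul, smul_eq_mul] at h2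
    linarith
  have hB : #(univ \ E) ≤ ∑ δ ∈ univ \ E, dif Y δ := by
    have h2 : ∑ δ ∈ univ \ E, 2 * m ≤ ∑ δ ∈ univ \ E, (dif Y δ + Fintype.card H) :=
      sum_le_sum fun δ _ => hY ▸ two_mul_card_le_dif_add Y δ
    rw [sum_add_distrib, sum_const, sum_const, smul_eq_mul, smul_eq_mul] at h2
    have h3 : #(univ \ E) * (2 * m) = #(univ \ E) * Fintype.card H + #(univ \ E) := by rw [← hn]; ring
    linarith
  have hce : #(E.erase 0) + 1 = #E := card_erase_add_one h0
  have hcu : #(univ \ E) + #E = Fintype.card H := by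
    rw [card_sdiff_of_subset (subset_univ _), card_univ]; have := card_le_univ E; omega
  by_contra hlt
  obtain ⟨c, hc⟩ : ∃ c, #(E.erase 0) = m + 1 + c := ⟨#(E.erase 0) - (m + 1), by omega⟩
  rw [hc] at hA hce
  have hcm : c * 3 ≤ c * m := Nat.mul_le_mul_left c (by omega)
  have e1 : (m + 1 + c) * m = m * m + m + c * m := by ring
  rw [e1] at hA
  omega

end StepB

end Summit.MatrixMultiplication.OmegaCensus.CubeNB
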